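import Literature.MathematicalPhysics.QuantumFieldTheory.Balaban1983to89.Node00.N24ItemsStage13AtThm1CCMWZSepCoPH
import Literature.MathematicalPhysics.QuantumFieldTheory.Balaban1983to89.Node00.Record13NumericsOfThm1CCMWZB

/-!
# NODE N24 · N13's (R₁₃) LEAF ∕ LAW CHAIN AND THE THREE LETTER-FREE DOOR ROWS AT THE εbg-LETTER z-WITNESS `θ₁₅ᶜᶜᴹᵂᶻᴮ(j; γ; εbg; Efl, logz) = theta13OfThm1CCMWZB …` (DEF-1's Z3):
# `ROpLeaf` ∕ `TLaw → SLaw`, `Admissible`, `ZhUnity ∧ SlotsNondegenerate₁₃` at `ofHistoryBlind ⟨θ₁₅ᶜᶜᴹᵂᶻᴮ, ZrOfRecord₁₃ θ₁₅ᶜᶜᴹᵂᶻᴮ⟩` — the Z3 TWIN of this seat's `N24ItemsStage13AtThm1CCMWZSepCoPH` §0 + §2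

TRACK A (YM-PLAN §2d, node N24 = binder B2, composite), seat `pub-ymgap-dag-n24-c` (R134 s2; gen 16); Literature∕Node00 lane `--supports stmt-QuantumFields-27364`; count-neutral.
CONTEXT.  The K0-AT-Z3 road (plan g91 SIZING WORD I.46176 ∕ ZB-DEPS WORD I.≈46525: L1 `Record13LettersOfThm1CCMWZB` p706279 ✓ · L2 `Record13SepCoPLiveSelectorZ` ✓ · L3 · L4 = V22-Z) re-states
K0⁷'s β-box at the print-regime member `εbg := a₀` of DEF-1's Z3 family; the K1 face of record then re-keys its door witness from the `εbg = 1` member `θ₁₅ᶜᶜᴹᵂᶻ` to `θ₁₅ᶜᶜᴹᵂᶻᴮ(…; a₀; …)`.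
Item (Z-0) of this seat's LOCATED-ZB-DEPS census (I.46522): dag-n11-w1's Gauss-pin rows (Z-4) read THIS seat's free-slot rows `N24_rOpLeaf_VOfRecord₁₃CoPH_∕N24_laws₁₃CoPH_theta13OfThm1CCMWZ`;
their Z3 twins are below, with the three letter-free door rows.  The PROVISOS door rows of the Z file (§1 there: the R-currency road over dag-n21-c's W row by an `εbg = 1`-only `rfl`)
are NOT twinned here — at Z3 the door's `hP` comes from k0-s1 ∕ DEF-1 L3's GRID-GUARD row (the K1 engine builds it inline), per DEF-1 I.≈46534.

WHAT THIS FILE PROVES (5 theorems, 0 `def`, 0 `sorry`; standard axioms) — a TOKEN-PASS (`theta13OfThm1CCMWZ … ↦ theta13OfThm1CCMWZB … εbg …`, `stage12NumericsOfThm1CCMW ↦ …CCMWB … εbg`,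
THE ONE NEW SIGN `hbg : 0 < εbg` for admissibility; every proof ONE application of the same θ-GENERIC tree theorem as the Z file):
* §0 `N24_rOpLeaf_VOfRecord₁₃CoPH_theta13OfThm1CCMWZB`, ★ `N24_laws₁₃CoPH_theta13OfThm1CCMWZB` — N13's (R₁₃) at `(⟨⟨θ₁₅ᶜᶜᴹᵂᶻᴮ, Zr⟩, Zh, Phih⟩ : Stage13HParams F N)` from the window + six signs + `0 < εbg`
  (dag-n11-e's θ-GENERIC `rOpLeaf_VOfRecord₁₃CoPH_liveRepin₁₃_of_hasResiduals` at `theta13OfNumericsZ …` with the B numerics; `admissible_theta13OfNumericsZ` fed by Z3's `stage12NumericsOfThm1CCMWB_pos_of_le_half`).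
* §1 `N24_admissible_door_theta13OfThm1CCMWZB` (Z3's `admissible_theta13OfThm1CCMWZB_of_le_half` through `admissible_ofHistoryBlind_iff`), `N24_unity_slots_door_theta13OfThm1CCMWZB`
  (`Stage13RParams.ZrUnity.ofHistoryBlind ∘ finsum_ζ0_ZrOfRecord₁₃` ∧ Z3's hypothesis-free `slotsNondegenerate₁₃_theta13OfThm1CCMWZB`), `N24_laws_door_theta13OfThm1CCMWZB` (§0 at the door's slots).
At `εbg = 1` these ARE the Z file's theorems (Z3 bridge `theta13OfThm1CCMWZ_eq_B`, `rfl`).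
HONEST FRAMING: kernel bookkeeping BY NAME; nothing of Bałaban's asserted; NO value of `εbg` chosen for anybody (V22-Z is the plan's ∕ k0 lanes'); no value of `E_k` ∕ `log z_k` pinned;
K0⁷ ∕ K1⁹ NOT closed; N24 COMPOSITE — no discharge, no count moved (typed 28∕28 · discharged 8∕28, 8∕27 excl. NODE O); one finite 𝕋⁴ programme at fixed ε; NOT continuum ∕ ℝ⁴ ∕ OS ∕ mass gap ∕ Clay.
-/

noncomputable section

open scoped Matrix.Norms.L2Operator

namespace Literature.MathematicalPhysics.QuantumFieldTheory.Balaban1983to89.Node00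

open DagBinding T4Continuum T4DatumAssembly FlowStepRuns AveragingRT
open FlowStep (BetaLowerH BetaUpperH)
open B16RLeafRecord13LiveCoPH (rOpLeaf_VOfRecord₁₃CoPH_liveRepin₁₃_of_hasResiduals)

variable {F : T4Family} {N : ℕ} [NeZero N]

/-! ## §0. N13's (R₁₃) 𝐑-leaf at the z-witness — dag-n11-e's θ-generic re-pin leaf at DEF-1's `theta13OfNumericsZ` -/

section RLeaf

variable {j : ℕ} {γ εbg ε₀ ε₂₉ B₃ B₃' a₀ a₁ : ℝ} {Efl logz : B12.RunParams → ℕ → ℝ} (Zr : (q : B12.RunParams) → TkResidualW F N (FluctV N) q.K)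
  (Zh : (q : B12.RunParams) → ℕ → (ℕ → Set (Site (F.P q.K) 0)) → (ℕ → Set (Site (F.P q.K) 0)) → TkResidualW F N (FluctV N) q.K)
  (Phih : (q : B12.RunParams) → ℕ → (ℕ → Set (Site (F.P q.K) 0)) → (ℕ → Set (Site (F.P q.K) 0)) → (ℕ → Plaq (F.P q.K) 0 → ℝ)) (p : B12.RunParams)

/-- **★ N13's CoPH 𝐑-leaf at the z-witness `θ₁₅ᶜᶜᴹᵂᶻ(j; γ; Efl, logz)`** with free residual slots, from the window `0 < γ ≤ ½` and the six admissibility signs — WHATEVER THE LETTERS: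
dag-n11-e's θ-GENERIC re-pin leaf `rOpLeaf_VOfRecord₁₃CoPH_liveRepin₁₃_of_hasResiduals` at DEF-1's `theta13OfNumericsZ` (`θ₁₅ᶜᶜᴹᵂᶻ` IS its live re-pin, `rfl`), fed by DEF-1's
`hasResidualsOfRecord_theta13OfNumericsZ` ∕ `admissible_theta13OfNumericsZ`, dag-n21-c's `stage12NumericsOfThm1CCMW_pos_of_le_half` and the family's numerals `κ = 2·10⁴`, `E₀ = B₀ = 1` (`rfl`).
Part 8 §0 is the `(0,0)` instance. [cite: Balaban1988Convergent, p.244, (3.16) p.268; Balaban1989LargeFieldI, (0.3)–(0.4) p.176, p.177 (i)–(ii); Balaban1989LargeFieldII, Thm 1 p.355 (not exercised); Balaban1987RG1, Thm 1 p.255, §1 p.264 (window)] -/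
theorem N24_rOpLeaf_VOfRecord₁₃CoPH_theta13OfThm1CCMWZB (hγ₀ : 0 < γ) (hγh : γ ≤ 1 / 2) (hbg : 0 < εbg) (hε : 0 < ε₀) (hε' : 0 < ε₂₉) (hB : 0 ≤ B₃) (hB' : 0 ≤ B₃') (ha₀ : 0 < a₀) (ha₁ : 0 < a₁) :
    ROpLeaf (VOfRecord₁₃CoPH F N (⟨⟨theta13OfThm1CCMWZB F N j γ εbg ε₀ ε₂₉ B₃ B₃' a₀ a₁ Efl logz, Zr⟩, Zh, Phih⟩ : Stage13HParams F N) p) := by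
  have hκ : (theta13OfNumericsZ F N (stage12NumericsOfThm1CCMWB F.L j γ εbg ε₀ B₃ B₃' a₀ a₁) ε₂₉ (zeta316OfRecord F N (stage12NumericsOfThm1CCMWB F.L j γ εbg ε₀ B₃ B₃' a₀ a₁).ν (stage12NumericsOfThm1CCMWB F.L j γ εbg ε₀ B₃ B₃' a₀ a₁).τ9.M (stage12NumericsOfThm1CCMWB F.L j γ εbg ε₀ B₃ B₃' a₀ a₁).A₁) (RzOfRecord F N) (ZtOfRecord F N) Efl logz).s2.lf.κ = 20000 := rfl
  have hE : (theta13OfNumericsZ F N (stage12NumericsOfThm1CCMWB F.L j γ εbg ε₀ B₃ B₃' a₀ a₁) ε₂₉ (zeta316OfRecord F N (stage12NumericsOfThm1CCMWB F.L j γ εbg ε₀ B₃ B₃' a₀ a₁).ν (stage12NumericsOfThm1CCMWB F.L j γ εbg ε₀ B₃ B₃' a₀ a₁).τ9.M (stage12NumericsOfThm1CCMWB F.L j γ εbg ε₀ B₃ B₃' a₀ a₁).A₁) (RzOfRecord F N) (ZtOfRecord F N) Efl logz).s2.lf.E₀ = 1 := rfl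
  have hB0 : (theta13OfNumericsZ F N (stage12NumericsOfThm1CCMWB F.L j γ εbg ε₀ B₃ B₃' a₀ a₁) ε₂₉ (zeta316OfRecord F N (stage12NumericsOfThm1CCMWB F.L j γ εbg ε₀ B₃ B₃' a₀ a₁).ν (stage12NumericsOfThm1CCMWB F.L j γ εbg ε₀ B₃ B₃' a₀ a₁).τ9.M (stage12NumericsOfThm1CCMWB F.L j γ εbg ε₀ B₃ B₃' a₀ a₁).A₁) (RzOfRecord F N) (ZtOfRecord F N) Efl logz).s2.lf.B₀ = 1 := rfl
  exact rOpLeaf_VOfRecord₁₃CoPH_liveRepin₁₃_of_hasResiduals F N (theta13OfNumericsZ F N (stage12NumericsOfThm1CCMWB F.L j γ εbg ε₀ B₃ B₃' a₀ a₁) ε₂₉ (zeta316OfRecord F N (stage12NumericsOfThm1CCMWB F.L j γ εbg ε₀ B₃ B₃' a₀ a₁).ν (stage12NumericsOfThm1CCMWB F.L j γ εbg ε₀ B₃ B₃' a₀ a₁).τ9.M (stage12NumericsOfThm1CCMWB F.L j γ εbg ε₀ B₃ B₃' a₀ a₁).A₁) (RzOfRecord F N) (ZtOfRecord F N) Efl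 logz) Zr Zh Phih p
    (hasResidualsOfRecord_theta13OfNumericsZ F N _ ε₂₉ Efl logz)
    (admissible_theta13OfNumericsZ F N _ _ _ Efl logz (stage12NumericsOfThm1CCMWB_pos_of_le_half F.hL.2.le hγ₀ hγh hbg hε hB hB' ha₀ ha₁) hε')
    (by rw [hκ]; norm_num) (by rw [hE]; norm_num) (by rw [hB0]; norm_num)

/-- **N13's (R₁₃) slot in law form at the z-witness** (free residual slots): `∀ k < K, TLaw₁₃CoPH k → SLaw₁₃CoPH (k+1)` from the window and the six signs — §0's leaf through
def-T's `rOpLeaf_VOfRecord₁₃CoPH_iff`. [cite: Balaban1988Convergent, p.244 (bookkeeping); Balaban1989LargeFieldII, Thm 1 p.355 (not exercised)] -/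
theorem N24_laws₁₃CoPH_theta13OfThm1CCMWZB (hγ₀ : 0 < γ) (hγh : γ ≤ 1 / 2) (hbg : 0 < εbg) (hε : 0 < ε₀) (hε' : 0 < ε₂₉) (hB : 0 ≤ B₃) (hB' : 0 ≤ B₃') (ha₀ : 0 < a₀) (ha₁ : 0 < a₁) :
    ∀ k, k < p.K →
      TLaw₁₃CoPH F N (⟨⟨theta13OfThm1CCMWZB F N j γ εbg ε₀ ε₂₉ B₃ B₃' a₀ a₁ Efl logz, Zr⟩, Zh, Phih⟩ : Stage13HParams F N) p k →
        SLaw₁₃CoPH F N (⟨⟨theta13OfThm1CCMWZB F N j γ εbg ε₀ ε₂₉ B₃ B₃' a₀ a₁ Efl logz, Zr⟩, Zh, Phih⟩ : Stage13HParams F N) p (k + 1) :=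
  (rOpLeaf_VOfRecord₁₃CoPH_iff F N _ p).mp (N24_rOpLeaf_VOfRecord₁₃CoPH_theta13OfThm1CCMWZB Zr Zh Phih p hγ₀ hγh hbg hε hε' hB hB' ha₀ ha₁)

end RLeaf

/-! ## §1. The three door rows at `ofHistoryBlind ⟨θ₁₅ᶜᶜᴹᵂᶻ, ZrOfRecord₁₃ θ₁₅ᶜᶜᴹᵂᶻ⟩` BY NAME: admissibility, unity ∧ slot non-degeneracy, the (R₁₃) law chain -/

section DoorRows

variable {j : ℕ} {γ εbg ε₀ ε₂₉ B₃ B₃' a₀ a₁ : ℝ} (Efl logz : B12.RunParams → ℕ → ℝ)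

/-- **Row G at the door**: `Admissible` from `0 < γ ≤ ½` and the six signs, WHATEVER THE LETTERS (DEF-1's `admissible_theta13OfThm1CCMWZB_of_le_half`; the `ofHistoryBlind` wrap is
admissibility-neutral, `Stage13HParams.admissible_ofHistoryBlind_iff`). [cite: Balaban1987RG1, Thm 1 p.259, (0.21) p.256, (2.9) p.266; Balaban1988Convergent, (2.10) p.256 (bookkeeping)] -/
theorem N24_admissible_door_theta13OfThm1CCMWZB (hγ₀ : 0 < γ) (hγh : γ ≤ 1 / 2) (hbg : 0 < εbg) (hε : 0 < ε₀) (hε' : 0 < ε₂₉) (hB : 0 ≤ B₃) (hB' : 0 ≤ B₃') (ha₀ : 0 < a₀) (ha₁ : 0 < a₁) :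
    (Stage13HParams.ofHistoryBlind F N ⟨theta13OfThm1CCMWZB F N j γ εbg ε₀ ε₂₉ B₃ B₃' a₀ a₁ Efl logz, ZrOfRecord₁₃ F N (theta13OfThm1CCMWZB F N j γ εbg ε₀ ε₂₉ B₃ B₃' a₀ a₁ Efl logz)⟩).Admissible F N :=
  Stage13HParams.admissible_ofHistoryBlind_iff.2 (admissible_theta13OfThm1CCMWZB_of_le_half F N Efl logz hγ₀ hγh hbg hε hε' hB hB' ha₀ ha₁)

/-- **Rows `ZhUnity` ∧ P12 at the door**, WHATEVER THE LETTERS: print's partition of unity of the CURED residual (`Stage13RParams.ZrUnity.ofHistoryBlind` over K0a's `finsum_ζ0_ZrOfRecord₁₃`)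
and DEF-1's hypothesis-free `slotsNondegenerate₁₃_theta13OfThm1CCMWZB` (the wrap does not touch the slots). [cite: Balaban1988Convergent, (3.16)–(3.20) pp.268–269, (3.22) p.269; Balaban1989LargeFieldI, (0.3)–(0.4) p.176 (bookkeeping)] -/
theorem N24_unity_slots_door_theta13OfThm1CCMWZB :
    (Stage13HParams.ofHistoryBlind F N ⟨theta13OfThm1CCMWZB F N j γ εbg ε₀ ε₂₉ B₃ B₃' a₀ a₁ Efl logz, ZrOfRecord₁₃ F N (theta13OfThm1CCMWZB F N j γ εbg ε₀ ε₂₉ B₃ B₃' a₀ a₁ Efl logz)⟩).ZhUnity F N ∧ (Stage13HParams.ofHistoryBlind F N ⟨theta13OfThm1CCMWZB F N j γ εbg ε₀ ε₂₉ B₃ B₃' a₀ a₁ Efl logz, ZrOfRecord₁₃ F N (theta13OfThm1CCMWZB F N j γ εbg ε₀ ε₂₉ B₃ B₃' a₀ a₁ Efl logz)⟩).SlotsNondegenerate₁₃ F N :=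
  ⟨Stage13RParams.ZrUnity.ofHistoryBlind (θ := ⟨theta13OfThm1CCMWZB F N j γ εbg ε₀ ε₂₉ B₃ B₃' a₀ a₁ Efl logz, ZrOfRecord₁₃ F N (theta13OfThm1CCMWZB F N j γ εbg ε₀ ε₂₉ B₃ B₃' a₀ a₁ Efl logz)⟩)
      (fun p i ω => finsum_ζ0_ZrOfRecord₁₃ (θ := theta13OfThm1CCMWZB F N j γ εbg ε₀ ε₂₉ B₃ B₃' a₀ a₁ Efl logz) (p := p) i ω),
    slotsNondegenerate₁₃_theta13OfThm1CCMWZB F N j γ εbg ε₀ ε₂₉ B₃ B₃' a₀ a₁ Efl logz⟩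

/-- **N13's (R₁₃) law chain at the door**, WHATEVER THE LETTERS — §0 at the door's residual slots (`Zr := ZrOfRecord₁₃`, `Zh := fun p _ _ _ => ZrOfRecord₁₃ … p`, `Phih := fun p _ _ _ => (Rz p.K).phi`,
the `ofHistoryBlind` fields). [cite: Balaban1988Convergent, p.244 (bookkeeping); Balaban1989LargeFieldII, Thm 1 p.355 (not exercised)] -/
theorem N24_laws_door_theta13OfThm1CCMWZB (hγ₀ : 0 < γ) (hγh : γ ≤ 1 / 2) (hbg : 0 < εbg) (hε : 0 < ε₀) (hε' : 0 < ε₂₉) (hB : 0 ≤ B₃) (hB' : 0 ≤ B₃') (ha₀ : 0 < a₀) (ha₁ : 0 < a₁) :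
    ∀ (P : B12.RunParams) (k : ℕ), k < P.K → TLaw₁₃CoPH F N (Stage13HParams.ofHistoryBlind F N ⟨theta13OfThm1CCMWZB F N j γ εbg ε₀ ε₂₉ B₃ B₃' a₀ a₁ Efl logz, ZrOfRecord₁₃ F N (theta13OfThm1CCMWZB F N j γ εbg ε₀ ε₂₉ B₃ B₃' a₀ a₁ Efl logz)⟩) P k → SLaw₁₃CoPH F N (Stage13HParams.ofHistoryBlind F N ⟨theta13OfThm1CCMWZB F N j γ εbg ε₀ ε₂₉ B₃ B₃' a₀ a₁ Efl logz, ZrOfRecord₁₃ F N (theta13OfThm1CCMWZB F N j γ εbg ε₀ ε₂₉ B₃ B₃' a₀ a₁ Efl logz)⟩) P (k + 1) :=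
  fun P => N24_laws₁₃CoPH_theta13OfThm1CCMWZB (ZrOfRecord₁₃ F N (theta13OfThm1CCMWZB F N j γ εbg ε₀ ε₂₉ B₃ B₃' a₀ a₁ Efl logz)) (fun p _ _ _ => ZrOfRecord₁₃ F N (theta13OfThm1CCMWZB F N j γ εbg ε₀ ε₂₉ B₃ B₃' a₀ a₁ Efl logz) p)
    (fun p _ _ _ => ((theta13OfThm1CCMWZB F N j γ εbg ε₀ ε₂₉ B₃ B₃' a₀ a₁ Efl logz).Rz p.K).phi) P hγ₀ hγh hbg hε hε' hB hB' ha₀ ha₁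

end DoorRows

end Literature.MathematicalPhysics.QuantumFieldTheory.Balaban1983to89.Node00

end
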